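import Summits.ResolutionOfSingularities.ResolutionOfSingularities.Theorems.HomologicalConductorNoZenoDim2Exhaustion
import Summits.ResolutionOfSingularities.ResolutionOfSingularities.Theorems.HomologicalConductorNoZenoExhaustionSandwich
import Literature.AlgebraicGeometry.Resolution.ArithmeticalThreefolds
import Literature.AlgebraicGeometry.Resolution.AffineDomainDimension
import HarnessLib

/-!
# Crux `NoZenoR` (stmt-ResolutionOfSingularities-19943) = `NoZeno` (stmt-16483), line `birth`:
# the kernel in transcendence degree three — exhaustion dichotomy and the Cossart–Piltant sandwich

OURS (cell res-hironaka, chain W4.4; lead res-L0-w44-lead-1). Nothing here is a statement of the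
manuscript under review. The registered high-dimensional stubs `stub_kernelRankOneHigh` /
`stub_kernelCompositeHighDim` (skeleton v11) carry no mechanism yet (KERNEL-L0 §15). This file lands
the two FREE structural facts that started the dimension-two analysis (v6 exhaustion, v7 sandwich),
now in transcendence degree three, so that a W4.4-high sub-chain starts from typed ground:

* `highDim_exhausts_or_exists_dominator` — DICHOTOMY, any transcendence degree: either the stages
  exhaust `O`, or some valuation ring `W` dominates the tower and contains an element residually
  transcendental over `k` (and, under the kernel hypothesis, `W` is not noetherian); this is the
  dimension-free part of the Case-B analysis (`exh_exists_dominator_of_not_mem_tower`, p460241);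
* `exists_regular_le_tower_of_cossartPiltant2019LU3` — SANDWICH in tr.deg ≤ 3 modulo the NAMED FACT
  `Literature.AlgebraicGeometry.Resolution.CossartPiltant2019LU3` (Cossart–Piltant 2019, local
  uniformization in dimension three, all characteristics): if the stages exhaust `O`, some REGULAR
  local `R ⊆ O` (`Frac R = K`, `loc O R = R`) lies in every late stage — the late stages are
  «sandwiched threefold singularities» over `R` threaded on `O` (via p463491
  `exh_exists_regular_le_tower_of_isLocallyUniformizable`).

In tr.deg ≥ 4 local uniformization is itself open (it is implied by the summit), so no sandwich is
available there: the high-dimensional kernel needs an intrinsic mechanism (KERNEL-L0 §15).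

References: S. Abhyankar, Amer. J. Math. 78 (1956), Lemma 7 [`Abhyankar1956Valuations`];
V. Cossart, O. Piltant, J. Algebra 529 (2019), Thm. 1.1, §4.1 [`CossartPiltant2019`].
-/

-- single-problem summit: the doubled namespace component `ResolutionOfSingularities` is forced
set_option linter.dupNamespace false

noncomputable section

namespace Summit.ResolutionOfSingularities.ResolutionOfSingularities.Theorems.NoZeno.Birth

open Polynomial Literature.AlgebraicGeometry.Resolution

variable {k K : Type} [Field k] [Field K] [Algebra k K]

/-- **Exhaustion dichotomy, any dimension.** For the canonical tower of a finitely generated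
`A ⊆ O` with `Frac A = K`: either every element of `O` lies in some stage, or there is a valuation
ring `W` of `K` DOMINATING the tower (`T_m ⊆ W`, `W`-units of `T_m` are `O`-units) together with an
element `t ∈ W ∩ O` outside every stage on which no non-zero polynomial over `k` has positive
`W`-value (so the residue field of `W` is transcendental over `k`); if moreover no noetherian
valuation ring dominates the tower (the kernel hypothesis), `W` is not noetherian.
[cite: Abhyankar1956Valuations, Lemma 7] -/
theorem highDim_exhausts_or_exists_dominator (O : ValuationSubring K) (A : Subalgebra k K)
    (hk : ∀ c : k, algebraMap k K c ∈ O) (hA : A.FG) (hfr : IsFractionRing ↥A K)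
    (hAO : A.toSubring ≤ O.toSubring)
    (hker : ∀ O' : ValuationSubring K,
      (∀ m : ℕ, ∀ s ∈ tower O A m, s ∈ O' ∧ (s⁻¹ ∈ O' → s⁻¹ ∈ O)) → ¬ IsNoetherianRing ↥O') :
    (∀ x : K, x ∈ O → ∃ m : ℕ, x ∈ tower O A m) ∨
      ∃ (W : ValuationSubring K) (t : K), t ∈ O ∧ t ∈ W ∧ (∀ m : ℕ, t ∉ tower O A m) ∧
        (∀ m : ℕ, ∀ s ∈ tower O A m, s ∈ W ∧ (s⁻¹ ∈ W → s⁻¹ ∈ O)) ∧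
        (∀ f : k[X], f ≠ 0 → ¬ W.valuation (aeval t f) < 1) ∧ ¬ IsNoetherianRing ↥W := by
  by_cases hexh : ∀ x : K, x ∈ O → ∃ m : ℕ, x ∈ tower O A m
  · exact Or.inl hexh
  · right
    push Not at hexh
    obtain ⟨t, htO, ht⟩ := hexh
    obtain ⟨W, htW, hdom, hres⟩ := exh_exists_dominator_of_not_mem_tower O A hk hA hfr hAO htO ht
    exact ⟨W, t, htO, htW, ht, hdom, hres, hker W hdom⟩

/-- **The Cossart–Piltant sandwich in transcendence degree ≤ 3** (modulo the named fact
`CossartPiltant2019LU3`): if the stages exhaust `O` and `tr.deg_k K ≤ 3`, a REGULAR local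
`k`-subalgebra `R ⊆ O` with `Frac R = K` and `loc O R = R` lies in every late stage `T_m`, `m ≥ m₀`.
The affine model `A` has Krull dimension `≤ 3` (`ringKrullDim_le_of_fg_of_trdeg_le`), so `O` is
locally uniformizable over `k` by Cossart–Piltant, and cofinality of the exhausting tower
(`exh_exists_regular_le_tower_of_isLocallyUniformizable`, p463491) does the rest.
[cite: CossartPiltant2019, Thm. 1.1 with §4.1 (LU)] -/
theorem exists_regular_le_tower_of_cossartPiltant2019LU3 (hLU3 : CossartPiltant2019LU3.{0})
    (O : ValuationSubring K) (A : Subalgebra k K) (hk : ∀ c : k, algebraMap k K c ∈ O)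
    (hA : A.FG) (hfr : IsFractionRing ↥A K) (hAO : A.toSubring ≤ O.toSubring)
    (htr : Algebra.trdeg k K ≤ 3) (hexh : ∀ x : K, x ∈ O → ∃ m : ℕ, x ∈ tower O A m) :
    ∃ R : Subalgebra k K, IsRegularLocalRing ↥R ∧ IsFractionRing ↥R K ∧
      R.toSubring ≤ O.toSubring ∧ loc O R = R ∧
      ∃ m₀ : ℕ, ∀ m : ℕ, m₀ ≤ m → R ≤ tower O A m := by
  haveI := hfr
  have hdim : ringKrullDim ↥A ≤ 3 :=
    ringKrullDim_le_of_fg_of_trdeg_le A hA (by exact_mod_cast htr)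
  have hLU : IsLocallyUniformizable k K O :=
    CossartPiltant2019LU3.isLocallyUniformizable hLU3 k K O A hAO hA hfr hdim
  exact exh_exists_regular_le_tower_of_isLocallyUniformizable O A hk hAO hexh hLU

end Summit.ResolutionOfSingularities.ResolutionOfSingularities.Theorems.NoZeno.Birth

end
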